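import Summits.CriticalPhenomena.PercolationContinuityZ3.Theorems.Transplant.PlanarSkeletonFrmFromDefs
import Summits.CriticalPhenomena.PercolationContinuityZ3.Theorems.Transplant.PlanarSkeletonFrmReflect
import HarnessLib

/-!
# Coordinate reflections of a `PlanarSkeletonFrmFrom` — the def-row twin of `PlanarSkeletonFrm.reflect` (PlanarSkeletonFrmReflect :32, p333485) for the carrier
# of the binder wave (RULING D-U): `PlanarSkeletonFrmFrom.reflect s` (`φ ↦ (s₀φ₀, s₁φ₁)`; same types, frames, degree bound, width `ℓ₀`; steps re-signed; cylinders
# equal as sets) and its API `reflect_types/ℓ₀/φ/cyl/cylSubcritical_iff/sub`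

builds on p205010 (kernel theorem, internal audit signed; external expert review pending) — nothing in this file uses p205010.  RULING D-U stage W0.1 (lead g21,
2026-08-26), def-row companion of «PlanarSkeletonFrmFrom1»; one definition (`reflect`, the structure-valued twin of a landed definition — review-queued by D-0009),
no statement, no `@[conjecture]`; NOTHING about U / U_s / the end state claimed.  Lane `prim-bschramm`, seat `prim-bschramm-p3` gen 26; helper file
(`--supports stmt-CriticalPhenomena-4575 --as helper`).  Proofs = PlanarSkeletonFrmReflect :32–:100 verbatim with the carrier token changed and the field `ℓ₀` carried;
the third direct reader of (κ) in the closed node's used proof term (`reflect._proof_4`, P3-NILPOTENT §19.8) re-typed under (κ′).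
[cite: KozmaNitzan2024, §4 p. 15 (boxes and their translates)] [cite: MartineauTassion2017, §3.2] [this work]
-/

noncomputable section

namespace Summit.CriticalPhenomena.PercolationContinuityZ3.Theorems.Transplant

open Literature.Probability.Percolation Literature.Probability.LatticeModels SimpleGraph
open scoped Classical

namespace PlanarSkeletonFrmFrom

variable {V : Type} {G : SimpleGraph V} [G.LocallyFinite]

/-! ## §1 The reflected skeleton and its API -/

/-- **The reflected skeleton** `φ ↦ (s₀φ₀, s₁φ₁)`: still a `PlanarSkeletonFrmFrom` (same types, frames, degree bound, width `ℓ₀`; steps re-signed; cylinders equal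
as sets). [this work] -/
def reflect (Φ : PlanarSkeletonFrmFrom G) (s : Fin 2 → ℤˣ) : PlanarSkeletonFrmFrom G where
  φ := fun w i => (s i : ℤ) * Φ.φ w i
  lip := by
    intro u v huv i
    have := Φ.lip huv i
    rw [← mul_sub, Literature.Probability.Percolation.BGN.abs_units_mul]; exact this
  types := Φ.types
  frame := by
    intro v
    obtain ⟨t, ht, α, hαt, hα⟩ := Φ.frame v
    refine ⟨t, ht, α, hαt, fun w => ?_⟩
    ext i
    simp only [Pi.add_apply, Pi.sub_apply, hα w]
    ring
  Δ := Φ.Δ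
  degree_le := Φ.degree_le
  step := by
    intro v i σ
    obtain ⟨v', hadj, hφ⟩ := Φ.step v i (σ * s i)
    refine ⟨v', hadj, ?_⟩
    ext j
    rw [Pi.add_apply, hφ, Pi.add_apply, mul_add]
    congr 1
    by_cases hj : j = i
    · subst hj
      rw [Pi.single_eq_same, Pi.single_eq_same, Units.val_mul]
      have := Literature.Probability.Percolation.BGN.units_mul_self (s j)
      calc (s j : ℤ) * (σ * s j) = σ * ((s j : ℤ) * s j) := by ring
        _ = σ := by rw [this, mul_one]
    · rw [Pi.single_eq_of_ne hj, Pi.single_eq_of_ne hj, mul_zero]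
  ℓ₀ := Φ.ℓ₀
  cyl_connected := by
    intro t ht ℓ hℓ
    have hset : {w : V | (fun i => (s i : ℤ) * Φ.φ w i) - (fun i => (s i : ℤ) * Φ.φ t i) ∈ box 2 ℓ} = {w : V | Φ.φ w - Φ.φ t ∈ box 2 ℓ} := by
      ext w
      simp only [Set.mem_setOf_eq]
      have e : ((fun i => (s i : ℤ) * Φ.φ w i) - fun i => (s i : ℤ) * Φ.φ t i) = fun i => (s i : ℤ) * (Φ.φ w - Φ.φ t) i := by
        ext i; simp only [Pi.sub_apply]; ring
      rw [e, PlanarSkeletonFrm.smul_mem_box_iff]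
    rw [hset]
    exact Φ.cyl_connected t ht ℓ hℓ

/-- The reflected skeleton has the same base vertices. [folklore] -/
@[simp] theorem reflect_types (Φ : PlanarSkeletonFrmFrom G) (s : Fin 2 → ℤˣ) : (Φ.reflect s).types = Φ.types := rfl

/-- The reflected skeleton has the same width `ℓ₀`. [folklore] -/
@[simp] theorem reflect_ℓ₀ (Φ : PlanarSkeletonFrmFrom G) (s : Fin 2 → ℤˣ) : (Φ.reflect s).ℓ₀ = Φ.ℓ₀ := rfl

/-- The reflected chart, unfolded. [folklore] -/
@[simp] theorem reflect_φ (Φ : PlanarSkeletonFrmFrom G) (s : Fin 2 → ℤˣ) (w : V) (i : Fin 2) : (Φ.reflect s).φ w i = (s i : ℤ) * Φ.φ w i := rfl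

/-- The reflected skeleton has the same cylinders. [folklore] -/
theorem reflect_cyl (Φ : PlanarSkeletonFrmFrom G) (s : Fin 2 → ℤˣ) (t : V) (ℓ : ℕ) : (Φ.reflect s).cyl t ℓ = Φ.cyl t ℓ := by
  ext w
  simp only [cyl, Set.mem_setOf_eq]
  have e : ((Φ.reflect s).φ w - (Φ.reflect s).φ t) = fun i => (s i : ℤ) * (Φ.φ w - Φ.φ t) i := by
    ext i; simp only [Pi.sub_apply, reflect_φ]; ring
  rw [e, PlanarSkeletonFrm.smul_mem_box_iff]

/-- **Φ2 is invariant under coordinate reflections.** [folklore] -/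
theorem reflect_cylSubcritical_iff (Φ : PlanarSkeletonFrmFrom G) (s : Fin 2 → ℤˣ) (p : unitInterval) :
    (Φ.reflect s).CylSubcritical p ↔ Φ.CylSubcritical p := by
  unfold CylSubcritical
  refine forall₂_congr fun t _ => forall_congr' fun ℓ => ?_
  have hS : (Φ.reflect s).cyl t ℓ = Φ.cyl t ℓ := Φ.reflect_cyl s t ℓ
  have key : ∀ (S S' : Set V) (_ : S = S') (hm : t ∈ S) (hm' : t ∈ S'),
      theta (G.induce S) ⟨t, hm⟩ p = theta (G.induce S') ⟨t, hm'⟩ p := by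
    intro S S' e hm hm'; subst e; rfl
  constructor
  · intro h; rw [← key _ _ hS]; exact h
  · intro h; rw [key _ _ hS]; exact h

/-- Relative coordinates of the reflected chart: `φˢ w − φˢ t = (sᵢ·(φ w − φ t)ᵢ)ᵢ`. [folklore] -/
theorem reflect_sub (Φ : PlanarSkeletonFrmFrom G) (s : Fin 2 → ℤˣ) (w t : V) (i : Fin 2) :
    (Φ.reflect s).φ w i - (Φ.reflect s).φ t i = (s i : ℤ) * (Φ.φ w i - Φ.φ t i) := by
  simp only [reflect_φ]; ring

end PlanarSkeletonFrmFrom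

end Summit.CriticalPhenomena.PercolationContinuityZ3.Theorems.Transplant

end
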